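import Summits.Langlands.Langlands.Theses.DedekindQuotient1951
import Summits.Langlands.Langlands.Theorems.DedekindQuotient1951PartialLEntireGJ
import Literature.NumberTheory.Automorphic.AutomorphicRepsGLSatakeDictionaryHolds
import Literature.NumberTheory.Automorphic.AutomorphicRepsGLAssociatedL2Holds
import Literature.NumberTheory.Automorphic.AutomorphicLFunctionHolds

/-!
# Route `DedekindQuotient1951` (Langlands) — support `PartialLEntire` (stmt-Langlands-17273)

`PartialLEntire`: for `n ≥ 2`, a cuspidal automorphic representation `π` of `GL_n(𝔸_ℚ)` in the
Borel–Jacquet model (`CuspidalAutomorphicRepData`), a finite set `S` of finite places and Satake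
parameters `α` of `π` off `S`, the partial standard Euler product `∏_{v ∉ S} ∏_{a ∈ α v} (1 - a N v^{-s})⁻¹`
converges on a right half-plane to the values of an entire function.

This file reduces the statement to its one analytic input, Godement–Jacquet's theorem in the `L²`
model of the tree (hypothesis `hW`, PROVED in the sibling file `DedekindQuotient1951PartialLEntireGJ`
as `hasEntireContinuation_partialStandardL_of_two_le`: for
cuspidal `Π ⊂ L²_cusp(GL_n(K) A_G \ GL_n(𝔸_K))`, `n ≥ 2`, and an honest Satake family `α` off a finite
`S`, `L^S(s, Π)` has entire continuation; Godement–Jacquet 1972, Thm. 13.8 with Thm. 3.3), through the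
Borel–Jacquet dictionary between the datum model and `L²`, which is a theorem of the tree at every
place (`CuspidalAutomorphicRepData.exists_clean_hasSatakeParamAt_iff_of_sSup_irreducible`,
`CuspidalAutomorphicRepData.exists_satake_eq_cpow_mul_L2_pointwise` fed with
`AutomorphicRepsGL.exists_isAssociatedL2_holds`, `hasSatakeParamAt_iff_L2_holds`,
`AutomorphicRepsGL.stable_cuspidal_eq_sSup_irreducible_holds`, `AdelicGroupData.exists_isAutomorphicMeasure_gl_holds`),
and Jacquet–Shalika's convergence of the partial Euler product on `re s > 1`
(`multipliable_partialStandardL_holds`). The `q^{z}`-shift of the dictionary only moves the abscissa.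
The closing theorem `PartialLEntire_proof` is unconditional.
-/

set_option linter.dupNamespace false

noncomputable section

open NumberField IsDedekindDomain MeasureTheory
open Literature.NumberTheory.Automorphic Literature.NumberTheory.GaloisRepresentations

namespace Summit.Langlands.Langlands.Theorems.DedekindQuotient1951

/-- **`PartialLEntire` from the `L²`-side Godement–Jacquet theorem.** Granting, for every
`n ≥ 2`, number field `K`, automorphic measure `μ`, cuspidal `Π ⊂ L²_cusp(GL_n(K) A_G \ GL_n(𝔸_K))`,
finite `S` and honest Satake family `α` of `Π` off `S`, that the partial standard L-function
`L^S(s, Π)` has entire continuation (Godement–Jacquet 1972, Thm. 13.8 with Thm. 3.3;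
Jacquet–Shalika 1981, Thm. (5.3)), the route's support statement `PartialLEntire` holds: the
Borel–Jacquet datum `π` has, at every place, the Satake parameters `q_v^{z} t_{Π,v}` of a shift of a
cuspidal `Π ⊂ L²_cusp` (pointwise dictionary, unconditional in the tree:
`exists_clean_hasSatakeParamAt_iff_of_sSup_irreducible`, `exists_satake_eq_cpow_mul_L2_pointwise`),
so the partial Euler product of `π` off `S` at `s` is `L^S(s - z, Π)`, which converges for
`re s > 1 + re z` (Jacquet–Shalika, `multipliable_partialStandardL_holds`) to the value of the
entire function `s ↦ G(s - z)`. [cite: GodementJacquet1972, Thm. 13.8]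
[cite: BorelJacquetCorvallis1979, 4.6, 5.7] -/
theorem PartialLEntire_of_hasEntireContinuation_partialStandardL
    (hW : ∀ (n : ℕ) (K : Type) [Field K] [NumberField K]
      (μ : Measure (AdelicGroupData.gl n K).automorphicQuotient)
      [(AdelicGroupData.gl n K).IsAutomorphicMeasure μ]
      (P : CuspidalAutomorphicRepGL n K μ), 2 ≤ n →
      ∀ (S : Finset (HeightOneSpectrum (𝓞 K))) (α : SatakeFamily K),
        IsSatakeFamilyOf P ↑S α → LFunction.HasEntireContinuation (partialStandardL ↑S α)) :
    Summit.Langlands.Langlands.Theses.DedekindQuotient1951.PartialLEntire := by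
  intro n hn hcpt π S hS α hα
  classical
  haveI : NeZero n := ⟨by omega⟩
  obtain ⟨S₀, rfl⟩ := hS.exists_finset_coe
  obtain ⟨μ, hμ⟩ := AdelicGroupData.exists_isAutomorphicMeasure_gl_holds (n := n) (K := ℚ)
  haveI := hμ
  -- the pointwise Borel–Jacquet dictionary `t_{π,v} = q_v^z t_{Π,v}` at every place
  obtain ⟨π₀, h0W', h0π⟩ :=
    CuspidalAutomorphicRepData.exists_clean_hasSatakeParamAt_iff_of_sSup_irreducible
      (AutomorphicRepsGL.stable_cuspidal_eq_sSup_irreducible_holds (hcpt := hcpt)) π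
  obtain ⟨z, P, S₁, αP, -, -, -, hdict⟩ :=
    CuspidalAutomorphicRepData.exists_satake_eq_cpow_mul_L2_pointwise
      (AutomorphicRepsGL.exists_isAssociatedL2_holds hcpt μ) (hasSatakeParamAt_iff_L2_holds hcpt μ)
      π π₀ h0W' h0π
  -- the shifted family `α' = q^{-z} α` is an honest Satake family of `Π` off `S`
  set α' : SatakeFamily ℚ := fun v => (α v).map (((v.residueCard : ℂ) ^ (-z)) * ·) with hα'
  have hfam : IsSatakeFamilyOf P (↑S₀ : Set (HeightOneSpectrum (𝓞 ℚ))) α' := by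
    intro v hv
    obtain ⟨𝔫, ϖ, h𝔫, hv𝔫, hSat⟩ := (hdict v (α v)).mp (hα v hv)
    exact ⟨𝔫, h𝔫, hv𝔫, ϖ, hSat⟩
  obtain ⟨G, hG, hGL⟩ := hW n ℚ μ P hn S₀ α' hfam
  refine ⟨1 + z.re, fun s => G (s - z), hG.comp (differentiable_id.sub_const z), ?_⟩
  intro s hs
  have hs' : 1 < (s - z).re := by
    rw [Complex.sub_re]
    linarith
  -- the Euler factors of `π` at `s` are those of `Π` at `s - z`
  have key : (fun v : {v : HeightOneSpectrum (𝓞 ℚ) // v ∉ (↑S₀ : Set (HeightOneSpectrum (𝓞 ℚ)))} =>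
      (((α v.1).map fun a : ℂ => 1 - a * ((v.1.residueCard : ℂ) ^ (-s))).prod)⁻¹) =
      fun v => ((eulerPolynomial (α' v.1)).eval ((v.1.residueCard : ℂ) ^ (-(s - z))))⁻¹ := by
    funext v
    rw [eval_eulerPolynomial, hα', Multiset.map_map]
    congr 2
    refine Multiset.map_congr rfl fun a _ => ?_
    have hq : (v.1.residueCard : ℂ) ≠ 0 := by
      exact_mod_cast (zero_lt_one.trans v.1.one_lt_residueCard).ne'
    simp only [Function.comp_apply]
    rw [mul_comm ((v.1.residueCard : ℂ) ^ (-z)) a, mul_assoc, ← Complex.cpow_add _ _ hq]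
    congr 3
    ring
  rw [key]
  show HasProd _ (G (s - z))
  rw [hGL (s - z) hs']
  exact (multipliable_partialStandardL_holds P hfam hs').hasProd

/-- **`PartialLEntire` holds** (item stmt-Langlands-17273 of route `DedekindQuotient1951`,
unconditionally): the assembly `PartialLEntire_of_hasEntireContinuation_partialStandardL` fed with the
`L²`-side Godement–Jacquet theorem `hasEntireContinuation_partialStandardL_of_two_le`
(Godement–Jacquet 1972, Thm. 13.8: `L^S(s, Π)` is entire for cuspidal `Π` on `GL_n`, `n ≥ 2`).
[cite: GodementJacquet1972, Thm. 13.8] [cite: JacquetShalikaAJM1981, Thm. (5.3)]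
[cite: BorelJacquetCorvallis1979, 4.6, 5.7] -/
theorem PartialLEntire_proof : Summit.Langlands.Langlands.Theses.DedekindQuotient1951.PartialLEntire :=
  PartialLEntire_of_hasEntireContinuation_partialStandardL fun _ _ _ _ _ _ P hn S α hα =>
    hasEntireContinuation_partialStandardL_of_two_le P hn S α hα

end Summit.Langlands.Langlands.Theorems.DedekindQuotient1951

end
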